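import Mathlib
import Literature.AlgebraicGeometry.Resolution.RegularLocalRingsNormal
import Literature.AlgebraicGeometry.Resolution.RegularLocalRingsQuotient
import Literature.RingTheory.KrullDimension.AffineDimension
import Summits.ResolutionOfSingularities.ResolutionOfSingularities.Theorems.RadicialJungCleanModelsSufficeRegularTypeSop

/-!
# Route `RadicialJung`, crux `CleanModelsSuffice` (stmt-ResolutionOfSingularities-15883), line `Sketch`, skeleton v3:
# stub `stub_pIndep` — `p`-independence of regular parameters

Registered stub `stub_pIndep` of the skeleton of
`Summit.ResolutionOfSingularities.ResolutionOfSingularities.Theses.RadicialJung.CleanModelsSuffice`.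
Let `(A, 𝔪)` be a regular local ring, `tw₁, …, tw_d` a minimal system of generators of `𝔪`
(`d = dim A`) and `t_i = tw (ι i)` (`ι : Fin s ↪ Fin d`) some of them. If
`Σ_{e ∈ [0,p)^s} c_e^p ∏_i t_i^{e_i} = 0` with `c_e ∈ A`, then all `c_e = 0`. This is the linear
independence of the monomials `τ^e` (`τ_i^p = t_i`, `0 ≤ e_i < p`) used by the Kummer descent of
the line (`stub_kummerDescent`). The statement carries `CharP A p`, but the proof is
characteristic free and works for every exponent `q + 1 ≥ 1`.

## Proof

Induction on `s`, for all regular local rings at once, in the form `pIndep_aux`: the parameters are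
`t : Fin s → A` together with a finite set `rest` such that `𝔪 = (t, rest)` and `s + #rest ≤ dim A`
(so `t, rest` is a minimal system of generators).

* `s = 0`: the relation reads `c^{q+1} = 0`, and `A` is a domain (Matsumura 14.3,
  `isDomain_of_isRegularLocalRing`).
* `s + 1`: `x := t 0` lies in `𝔪 ∖ 𝔪²` (Nakayama: a member of a minimal system of generators,
  `pIndep_not_mem_sq`), hence `Ā = A/(x)` is regular of dimension `dim A - 1` (Matsumura 14.2,
  `IsRegularLocalRing.quotient_span_singleton`) with `𝔪_Ā` generated by the images of the other
  generators. Split `e = (k, e')` (`k = e 0`). CORE STEP: reducing the relation mod `x` kills the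
  terms with `k ≥ 1`, and the induction hypothesis in `Ā` gives `c_{(0,e')} ∈ (x)`. SHIFT
  (`pIndep_dvd_of_rel`): writing `c_{(0,e')} = x c'_{e'}`, the family
  `(c_{(1,e')}, …, c_{(q,e')}, c'_{e'})` again satisfies the relation (divide by `x` in the domain
  `A`), so by induction on `k` every `c_{(k,e')} ∈ (x)`. DESCENT (`pIndep_pow_dvd_of_rel`): then
  `c = x c₁` with `c₁` satisfying the relation, whence `c_e ∈ (x^N)` for all `N`, and Krull's
  intersection theorem (`Ideal.iInf_pow_eq_bot_of_isLocalRing`) gives `c_e = 0`.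

The SHIFT/DESCENT engine is isolated from regularity: it is stated for a domain `A`, an element
`x ≠ 0` with `⋂ (x^N) = 0`, arbitrary "monomials" `m : E → A`, and the CORE STEP as a hypothesis.

## Sources

H. Matsumura, *Commutative Ring Theory*, CUP 1986, Thms. 14.2, 14.3, 8.10 (Krull). The
`p`-independence statement itself is folklore (it is the freeness of `A` over `A^p[[…]]` in the
complete equicharacteristic case).

## Not here

Nothing about the overring `A[τ]`, its normality, or the Kummer descent (neighbouring stubs
`stub_rootOverring`, `stub_kummerDescent`, `stub_kummerNormal`).
-/

noncomputable section

set_option linter.dupNamespace false -- mandated namespace of this single-conjunct summit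

open IsLocalRing
open Literature.AlgebraicGeometry.Resolution

namespace Summit.ResolutionOfSingularities.ResolutionOfSingularities.Theorems.RadicialJung.CleanModelsSuffice

universe u

/-! ## The shift/descent engine (pure commutative algebra in a domain) -/

/-- SHIFT. Let `A` be a domain, `x ≠ 0`, `m : E → A` ("monomials in the other variables") and
suppose the CORE STEP: every family `c : Fin (q+1) → E → A` with
`Σ_k Σ_e c_{k,e}^{q+1} x^k m_e = 0` has `x ∣ c_{0,e}`. Then such a family has `x ∣ c_{k,e}` for
all `k`: write `c_{0,e} = x c'_e` and apply the core step to the shifted family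
`(c_{1,·}, …, c_{q,·}, c')`, which satisfies the same relation after cancelling `x`. [folklore] -/
theorem pIndep_dvd_of_rel {A : Type*} [CommRing A] [IsDomain A] {x : A} (hx0 : x ≠ 0) {q : ℕ}
    {E : Type*} [Fintype E] (m : E → A)
    (core : ∀ c : Fin (q + 1) → E → A,
      ∑ k, ∑ e, c k e ^ (q + 1) * (x ^ (k : ℕ) * m e) = 0 → ∀ e, x ∣ c 0 e)
    (c : Fin (q + 1) → E → A) (hc : ∑ k, ∑ e, c k e ^ (q + 1) * (x ^ (k : ℕ) * m e) = 0)
    (k : Fin (q + 1)) (e : E) : x ∣ c k e := by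
  induction k using Fin.induction generalizing c e with
  | zero => exact core c hc e
  | succ k ih =>
    have h0 : ∀ e, ∃ y, c 0 e = x * y := fun e => exists_eq_mul_right_of_dvd (core c hc e)
    choose c' hc' using h0
    -- the shifted family `(c 1, …, c q, c')`
    let c₂ : Fin (q + 1) → E → A := Fin.snoc (fun j => c j.succ) c'
    have h₂ : ∑ k, ∑ e, c₂ k e ^ (q + 1) * (x ^ (k : ℕ) * m e) = 0 := by
      have key : x * ∑ k, ∑ e, c₂ k e ^ (q + 1) * (x ^ (k : ℕ) * m e) =
          ∑ k, ∑ e, c k e ^ (q + 1) * (x ^ (k : ℕ) * m e) := by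
        rw [Finset.mul_sum, Fin.sum_univ_castSucc, Fin.sum_univ_succ, add_comm]
        congr 1
        · rw [Finset.mul_sum]
          refine Finset.sum_congr rfl fun e _ => ?_
          simp only [c₂, Fin.snoc_last, Fin.val_last, Fin.val_zero, hc']
          ring
        · refine Finset.sum_congr rfl fun j _ => ?_
          rw [Finset.mul_sum]
          refine Finset.sum_congr rfl fun e _ => ?_
          simp only [c₂, Fin.snoc_castSucc, Fin.val_castSucc, Fin.val_succ]
          ring
      rw [hc] at key
      exact (mul_eq_zero.mp key).resolve_left hx0
    have := ih c₂ h₂ e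
    simpa only [c₂, Fin.snoc_castSucc] using this

/-- DESCENT. In the situation of `pIndep_dvd_of_rel`, every family satisfying the relation is
divisible by all powers of `x`: `c = x • c₁` with `c₁` again satisfying the relation (cancel
`x^{q+1}`), and iterate. [folklore] -/
theorem pIndep_pow_dvd_of_rel {A : Type*} [CommRing A] [IsDomain A] {x : A} (hx0 : x ≠ 0) {q : ℕ}
    {E : Type*} [Fintype E] (m : E → A)
    (core : ∀ c : Fin (q + 1) → E → A,
      ∑ k, ∑ e, c k e ^ (q + 1) * (x ^ (k : ℕ) * m e) = 0 → ∀ e, x ∣ c 0 e) (N : ℕ) :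
    ∀ c : Fin (q + 1) → E → A, ∑ k, ∑ e, c k e ^ (q + 1) * (x ^ (k : ℕ) * m e) = 0 →
      ∀ k e, x ^ N ∣ c k e := by
  induction N with
  | zero => intro c _ k e; simp
  | succ N ih =>
    intro c hc k e
    have h : ∀ k e, ∃ y, c k e = x * y :=
      fun k e => exists_eq_mul_right_of_dvd (pIndep_dvd_of_rel hx0 m core c hc k e)
    choose c₁ hc₁ using h
    have h₁ : ∑ k, ∑ e, c₁ k e ^ (q + 1) * (x ^ (k : ℕ) * m e) = 0 := by
      have key : x ^ (q + 1) * ∑ k, ∑ e, c₁ k e ^ (q + 1) * (x ^ (k : ℕ) * m e) =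
          ∑ k, ∑ e, c k e ^ (q + 1) * (x ^ (k : ℕ) * m e) := by
        rw [Finset.mul_sum]
        refine Finset.sum_congr rfl fun k _ => ?_
        rw [Finset.mul_sum]
        refine Finset.sum_congr rfl fun e _ => ?_
        rw [hc₁ k e]
        ring
      rw [hc] at key
      exact (mul_eq_zero.mp key).resolve_left (pow_ne_zero _ hx0)
    rw [hc₁ k e, pow_succ']
    exact mul_dvd_mul_left x (ih c₁ h₁ k e)

/-- CONCLUSION of the engine: if moreover `⋂_N (x^N) = 0` (Krull), every family satisfying the
relation vanishes identically. [folklore] -/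
theorem pIndep_eq_zero_of_rel {A : Type*} [CommRing A] [IsDomain A] {x : A} (hx0 : x ≠ 0)
    (hxK : ∀ a : A, (∀ N : ℕ, x ^ N ∣ a) → a = 0) {q : ℕ} {E : Type*} [Fintype E] (m : E → A)
    (core : ∀ c : Fin (q + 1) → E → A,
      ∑ k, ∑ e, c k e ^ (q + 1) * (x ^ (k : ℕ) * m e) = 0 → ∀ e, x ∣ c 0 e)
    (c : Fin (q + 1) → E → A) (hc : ∑ k, ∑ e, c k e ^ (q + 1) * (x ^ (k : ℕ) * m e) = 0)
    (k : Fin (q + 1)) (e : E) : c k e = 0 :=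
  hxK _ fun N => pIndep_pow_dvd_of_rel hx0 m core N c hc k e

/-! ## Local algebra: Krull's intersection theorem and Nakayama -/

/-- Krull's intersection theorem for a principal ideal of a Noetherian local ring: an element
divisible by all powers of some `x ∈ 𝔪` is zero. [cite: Matsumura1987, Thm. 8.10] -/
theorem pIndep_eq_zero_of_forall_pow_dvd {A : Type*} [CommRing A] [IsNoetherianRing A]
    [IsLocalRing A] {x : A} (hx : x ∈ maximalIdeal A) (a : A) (ha : ∀ N : ℕ, x ^ N ∣ a) :
    a = 0 := by
  have h := Ideal.iInf_pow_eq_bot_of_isLocalRing (Ideal.span {x}) (Ideal.span_singleton_ne_top hx)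
  have ha' : a ∈ ⨅ N : ℕ, Ideal.span {x} ^ N := by
    refine Ideal.mem_iInf.mpr fun N => ?_
    rw [Ideal.span_singleton_pow, Ideal.mem_span_singleton]
    exact ha N
  rwa [h, Ideal.mem_bot] at ha'

/-- Nakayama: in a Noetherian local ring, if `𝔪` is generated by a finite set `S` with
`#S ≤ spanFinrank 𝔪` (a minimal system of generators), then no member of `S` lies in `𝔪²`.
[cite: Matsumura1987, Thm. 2.3] -/
theorem pIndep_not_mem_sq {R : Type*} [CommRing R] [IsLocalRing R] [IsNoetherianRing R]
    (S : Finset R) (hS : Ideal.span (S : Set R) = maximalIdeal R)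
    (hcard : S.card ≤ (maximalIdeal R).spanFinrank) {x : R} (hx : x ∈ S) :
    x ∉ (maximalIdeal R) ^ 2 := by
  -- adapted from `Literature.AlgebraicGeometry.Resolution.not_mem_sq_of_span_eq_maximalIdeal`
  -- (MonomializationAlongValuation.lean), reproved here to keep the imports algebraic
  classical
  intro hx2
  set N : Ideal R := Ideal.span ((S.erase x : Finset R) : Set R) with hN
  have hle : maximalIdeal R ≤ N ⊔ (maximalIdeal R) • (maximalIdeal R) := by
    conv_lhs => rw [← hS]
    rw [Ideal.span_le]
    intro y hy
    by_cases hyx : y = x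
    · subst hyx
      apply Ideal.mem_sup_right
      rw [Ideal.smul_eq_mul, ← pow_two]
      exact hx2
    · exact Ideal.mem_sup_left
        (Ideal.subset_span (Finset.mem_coe.mpr (Finset.mem_erase.mpr ⟨hyx, hy⟩)))
  have hfg : (maximalIdeal R).FG := (isNoetherianRing_iff_ideal_fg R).mp inferInstance _
  have hjac : maximalIdeal R ≤ (⊥ : Ideal R).jacobson := by
    rw [IsLocalRing.jacobson_eq_maximalIdeal ⊥ bot_ne_top]
  have hmN : maximalIdeal R ≤ N := Submodule.le_of_le_smul_of_le_jacobson_bot hfg hjac hle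
  have hNm : N ≤ maximalIdeal R := by
    rw [hN, ← hS]
    exact Ideal.span_mono (Finset.coe_subset.mpr (Finset.erase_subset _ _))
  have hEq : N = maximalIdeal R := le_antisymm hNm hmN
  have h1 : (maximalIdeal R).spanFinrank ≤ (S.erase x).card := by
    rw [← hEq, hN]
    exact Submodule.spanFinrank_span_le_ncard_of_finite (Finset.finite_toSet _) |>.trans
      (by rw [Set.ncard_coe_finset])
  have h2 : (S.erase x).card < S.card := Finset.card_erase_lt_of_mem hx
  omega

/-! ## `p`-independence of regular parameters -/

/-- **`p`-independence of regular parameters**, inductive form. Let `A` be a regular local ring of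
dimension `n`, `t : Fin s → A` and `rest ⊆ A` finite with `𝔪 = (t, rest)` and `s + #rest ≤ n`
(so `t, rest` is a minimal system of generators of `𝔪`). If
`Σ_{e : Fin s → Fin (q+1)} c_e^{q+1} ∏_i t_i^{e_i} = 0` then all `c_e = 0`. Induction on `s` via
`A/(t 0)` (Matsumura 14.2, 14.3), the shift/descent engine and Krull's intersection theorem.
[folklore] -/
theorem pIndep_aux (q : ℕ) : ∀ (s : ℕ) {A : Type u} [CommRing A] [IsRegularLocalRing A] (n : ℕ)
    (_hdim : ringKrullDim A = n) (t : Fin s → A) (rest : Finset A)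
    (_hspan : Ideal.span (Set.range t ∪ ↑rest) = maximalIdeal A) (_hcard : s + rest.card ≤ n)
    (c : (Fin s → Fin (q + 1)) → A)
    (_hc : ∑ e, c e ^ (q + 1) * ∏ i, t i ^ (e i : ℕ) = 0), ∀ e, c e = 0 := by
  intro s
  induction s with
  | zero =>
    intro A _ _ n _ t rest _ _ c hc e
    haveI := isDomain_of_isRegularLocalRing A
    rw [Fintype.sum_subsingleton _ e, Finset.univ_eq_empty, Finset.prod_empty, mul_one] at hc
    exact (pow_eq_zero_iff (Nat.succ_ne_zero q)).mp hc
  | succ s ih =>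
    intro A _ _ n hdim t rest hspan hcard c hc
    classical
    haveI := isDomain_of_isRegularLocalRing A
    -- `x := t 0 ∈ 𝔪 ∖ 𝔪²`
    have hx : t 0 ∈ maximalIdeal A := by
      rw [← hspan]
      exact Ideal.subset_span (Or.inl ⟨0, rfl⟩)
    have hμ : (maximalIdeal A).spanFinrank = n := by
      have h := IsRegularLocalRing.spanFinrank_maximalIdeal (R := A)
      rw [hdim] at h
      exact_mod_cast h
    have hx2 : t 0 ∉ maximalIdeal A ^ 2 := by
      refine pIndep_not_mem_sq (Finset.univ.image t ∪ rest) ?_ ?_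
        (Finset.mem_union_left _ (Finset.mem_image_of_mem t (Finset.mem_univ 0)))
      · rw [← hspan, Finset.coe_union, Finset.coe_image, Finset.coe_univ, Set.image_univ]
      · rw [hμ]
        refine (Finset.card_union_le _ _).trans ?_
        have h1 : (Finset.univ.image t).card ≤ s + 1 :=
          Finset.card_image_le.trans (by rw [Finset.card_univ, Fintype.card_fin])
        omega
    have hx0 : t 0 ≠ 0 := by
      intro h
      rw [h] at hx2
      exact hx2 (Ideal.zero_mem _)
    have hxK : ∀ a : A, (∀ N : ℕ, t 0 ^ N ∣ a) → a = 0 :=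
      fun a ha => pIndep_eq_zero_of_forall_pow_dvd hx a ha
    -- the regular local ring `Ā = A/(x)` of dimension `n - 1`
    set I : Ideal A := Ideal.span {t 0} with hI_def
    obtain ⟨hreg, hdimQ⟩ := IsRegularLocalRing.quotient_span_singleton hx hx2
    rw [← hI_def] at hreg hdimQ
    haveI := hreg
    obtain ⟨m', hm'⟩ := exists_nat_cast_eq_ringKrullDim (R := A ⧸ I)
    have hnm : m' + 1 = n := by
      rw [hm', hdim] at hdimQ
      exact_mod_cast hdimQ
    have hπ0 : Ideal.Quotient.mk I (t 0) = 0 :=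
      Ideal.Quotient.eq_zero_iff_mem.mpr (hI_def ▸ Ideal.mem_span_singleton_self (t 0))
    -- its maximal ideal is generated by the images of the other generators
    have hspan' : Ideal.span (Set.range (fun i : Fin s => Ideal.Quotient.mk I (t i.succ)) ∪
        ↑(rest.image (Ideal.Quotient.mk I))) = maximalIdeal (A ⧸ I) := by
      rw [← map_maximalIdeal_of_surjective (Ideal.Quotient.mk I) Ideal.Quotient.mk_surjective,
        ← hspan, Ideal.map_span, Set.image_union, ← Set.range_comp, Fin.range_fin_succ,
        Function.comp_apply, hπ0, Set.insert_union, Ideal.span_insert_zero, Finset.coe_image]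
      rfl
    have hcard' : s + (rest.image (Ideal.Quotient.mk I)).card ≤ m' := by
      have := Finset.card_image_le (s := rest) (f := Ideal.Quotient.mk I)
      omega
    -- monomials in the remaining parameters, and the CORE STEP via the induction hypothesis
    let mono : (Fin s → Fin (q + 1)) → A := fun e' => ∏ i, t i.succ ^ (e' i : ℕ)
    have core : ∀ c₀ : Fin (q + 1) → (Fin s → Fin (q + 1)) → A,
        ∑ k, ∑ e', c₀ k e' ^ (q + 1) * (t 0 ^ (k : ℕ) * mono e') = 0 →
          ∀ e', t 0 ∣ c₀ 0 e' := by
      intro c₀ hc₀ e'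
      rw [← Ideal.mem_span_singleton, ← Ideal.Quotient.eq_zero_iff_mem]
      refine ih m' hm' (fun i => Ideal.Quotient.mk I (t i.succ)) (rest.image (Ideal.Quotient.mk I))
        hspan' hcard' (fun e' => Ideal.Quotient.mk I (c₀ 0 e')) ?_ e'
      have h := congrArg (Ideal.Quotient.mk I) hc₀
      rw [map_sum, map_zero, Finset.sum_eq_single (0 : Fin (q + 1)) ?_ (by simp)] at h
      · rw [← h, map_sum]
        refine Finset.sum_congr rfl fun e' _ => ?_
        simp only [mono, map_mul, map_pow, map_prod, Fin.val_zero, pow_zero, one_mul]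
      · intro k _ hk
        have hk' : (k : ℕ) ≠ 0 := by
          intro h
          apply hk
          ext
          simp [h]
        rw [map_sum]
        refine Finset.sum_eq_zero fun e' _ => ?_
        simp only [map_mul, map_pow, hπ0, zero_pow hk', zero_mul, mul_zero]
    -- the relation, split as `e = Fin.cons k e'`
    have hct : ∑ k, ∑ e', (fun k e' => c (Fin.cons k e')) k e' ^ (q + 1) *
        (t 0 ^ (k : ℕ) * mono e') = 0 := by
      have h := hc
      rw [← (Fin.consEquiv fun _ : Fin (s + 1) => Fin (q + 1)).sum_comp,
        Fintype.sum_prod_type] at h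
      simp only [Fin.consEquiv_apply, Fin.prod_univ_succ, Fin.cons_zero, Fin.cons_succ] at h
      exact h
    intro e
    have h := pIndep_eq_zero_of_rel hx0 hxK mono core (fun k e' => c (Fin.cons k e')) hct (e 0)
      (Fin.tail e)
    simpa only [Fin.cons_self_tail] using h

/-- STUB (`p`-independence of regular parameters). Let `A` be a regular local ring of prime
characteristic `p`, `tw₁ … tw_d` a minimal system of generators of `𝔪_A` (`d = dim A`) and
`t_i = tw (ι i)` (`ι : Fin s ↪ Fin d`) some of them. If `Σ_{e ∈ [0,p)^s} c_e^p ∏ t_i^{e_i} = 0` with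
`c_e ∈ A`, then all `c_e = 0`. (Induction on `s`: reduce modulo `t_s`, a prime element with `A/(t_s)` regular
and `t_1 … t_{s-1}` still part of a minimal system; the coefficients with `e_s = 0` lie in `(t_s)`, divide by
`t_s`, cycle `e_s`; Krull's intersection theorem finishes.) [folklore] -/
theorem stub_pIndep {A : Type} [CommRing A] [IsRegularLocalRing A] (p : ℕ) (hp : p.Prime) [CharP A p]
    (s d : ℕ) (tw : Fin d → A) (hspan : Ideal.span (Set.range tw) = maximalIdeal A)
    (hdim : ringKrullDim A = (d : WithBot ℕ∞)) (ι : Fin s → Fin d) (hι : Function.Injective ι)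
    (c : (Fin s → Fin p) → A)
    (hc : ∑ e : Fin s → Fin p, c e ^ p * ∏ i : Fin s, tw (ι i) ^ (e i : ℕ) = 0) :
    ∀ e, c e = 0 := by
  classical
  obtain ⟨q, rfl⟩ : ∃ q, p = q + 1 := ⟨p - 1, (Nat.succ_pred_eq_of_pos hp.pos).symm⟩
  -- the generators not among the `t_i`
  set rest : Finset A := ((Finset.univ : Finset (Fin d)) \ Finset.univ.image ι).image tw
    with hrest
  refine pIndep_aux q s d hdim (fun i => tw (ι i)) rest ?_ ?_ c hc
  · rw [← hspan]
    congr 1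
    ext a
    simp only [hrest, Set.mem_union, Set.mem_range, Finset.coe_image, Finset.coe_sdiff,
      Finset.coe_univ, Set.mem_image, Set.mem_sdiff, Set.mem_univ, true_and, Set.image_univ,
      not_exists]
    constructor
    · rintro (⟨i, rfl⟩ | ⟨j, -, rfl⟩)
      exacts [⟨ι i, rfl⟩, ⟨j, rfl⟩]
    · rintro ⟨j, rfl⟩
      by_cases hj : ∃ i, ι i = j
      · obtain ⟨i, rfl⟩ := hj
        exact Or.inl ⟨i, rfl⟩
      · exact Or.inr ⟨j, not_exists.mp hj, rfl⟩
  · have h1 : rest.card ≤ d - s := by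
      refine Finset.card_image_le.trans ?_
      rw [Finset.card_sdiff_of_subset (Finset.subset_univ _), Finset.card_univ, Fintype.card_fin,
        Finset.card_image_of_injective _ hι, Finset.card_univ, Fintype.card_fin]
    have h2 : s ≤ d := by simpa using Fintype.card_le_of_injective ι hι
    omega

end Summit.ResolutionOfSingularities.ResolutionOfSingularities.Theorems.RadicialJung.CleanModelsSuffice

end
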